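import Mathlib
import HarnessLib
import Summits.AtomisticToContinuum.Crystallization.Theorems.PricedLinkCensusSoftLayerPropagationOneStackingMapSearchDefs

/-!
# One-stacking map engine: bookkeeping lemmas for the search states

Route `PricedLinkCensus`, crux `SoftLayerPropagation` (stmt-AtomisticToContinuum-14233), line
`Sketch`, stub `stub_oneStackingMap`.  The effect of `St.link` / `St.push` on positions, levels,
recorded neighbours and size; membership in `St.findAt`; the shadow embedding
`toE3 : V3 → ℝ³` (`v ↦ v / S`) with its additivity, injectivity and inner products.
All [folklore].
-/

noncomputable section

namespace Summit.AtomisticToContinuum.Crystallization.Theorems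

namespace OneStacking

open RealInnerProductSpace

/-! ### The shadow embedding `toE3` -/

/-- Euclidean `3`-space. -/
abbrev E3 : Type := EuclideanSpace ℝ (Fin 3)

/-- The shadow position of an integer vector: `v / S`. [folklore] -/
def toE3 (v : V3) : E3 := ((S : ℝ))⁻¹ • !₂[(v.x : ℝ), (v.y : ℝ), (v.z : ℝ)]

/-- The scale as a real number: `S = 2187 > 0`, in particular `S ≠ 0`. [folklore] -/
theorem S_real : (S : ℝ) ≠ 0 ∧ (0 : ℝ) < S := by constructor <;> norm_num [S]


/-- Coordinates of `toE3`. [folklore] -/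
theorem toE3_apply (v : V3) (t : Fin 3) :
    toE3 v t = ((S : ℝ))⁻¹ * (![(v.x : ℝ), v.y, v.z] t) := by
  simp [toE3]

/-- `toE3` is additive. [folklore] -/
theorem toE3_add (a b : V3) : toE3 (V3.add a b) = toE3 a + toE3 b := by
  ext t; fin_cases t <;> simp [toE3, V3.add] <;> ring

/-- `toE3` of a difference. [folklore] -/
theorem toE3_sub (a b : V3) : toE3 (V3.sub a b) = toE3 a - toE3 b := by
  ext t; fin_cases t <;> simp [toE3, V3.sub] <;> ring

/-- `toE3` of an integer multiple. [folklore] -/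
theorem toE3_smul (c : ℤ) (a : V3) : toE3 (V3.smul c a) = (c : ℝ) • toE3 a := by
  ext t; fin_cases t <;> simp [toE3, V3.smul] <;> ring

/-- `toE3 0 = 0`. [folklore] -/
theorem toE3_zero : toE3 V3.zero = 0 := by
  ext t; fin_cases t <;> simp [toE3, V3.zero]

/-- `toE3` is injective. [folklore] -/
theorem toE3_injective : Function.Injective toE3 := by
  intro a b h
  have h0 := congrArg (fun x : E3 => (S : ℝ) * x 0) h
  have h1 := congrArg (fun x : E3 => (S : ℝ) * x 1) h
  have h2 := congrArg (fun x : E3 => (S : ℝ) * x 2) h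
  simp only [toE3_apply, ← mul_assoc, mul_inv_cancel₀ S_real.1, one_mul] at h0 h1 h2
  simp only [Matrix.cons_val_zero, Matrix.cons_val_one, Matrix.cons_val] at h0 h1 h2
  cases a; cases b
  simp only [V3.mk.injEq]
  refine ⟨?_, ?_, ?_⟩ <;> assumption_mod_cast

/-- Inner products: `⟪toE3 a, toE3 b⟫ = (a · b) / S²`. [folklore] -/
theorem inner_toE3 (a b : V3) : ⟪toE3 a, toE3 b⟫ = (V3.dot a b : ℝ) / ((S : ℝ) ^ 2) := by
  rw [EuclideanSpace.inner_eq_star_dotProduct]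
  simp [toE3, V3.dot, dotProduct, Fin.sum_univ_three]
  field_simp

/-- Squared norms: `‖toE3 a‖² = |a|² / S²`. [folklore] -/
theorem norm_toE3_sq (a : V3) : ‖toE3 a‖ ^ 2 = (V3.n2 a : ℝ) / ((S : ℝ) ^ 2) := by
  rw [← real_inner_self_eq_norm_sq, inner_toE3]; rfl

/-- Unit shadow bonds: `‖toE3 a‖² = 2 ↔ |a|² = NN2`. [folklore] -/
theorem norm_toE3_sq_eq_two_iff (a : V3) : ‖toE3 a‖ ^ 2 = 2 ↔ V3.n2 a = NN2 := by
  rw [norm_toE3_sq, div_eq_iff (pow_ne_zero 2 S_real.1)]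
  constructor
  · intro h
    have : (V3.n2 a : ℝ) = ((2 * S * S : ℤ) : ℝ) := by push_cast; linarith [h]
    exact_mod_cast this
  · intro h; rw [h]; simp [NN2]; ring

/-! ### Vector identities -/

/-- `a - b` componentwise. [folklore] -/
theorem V3.sub_eq (a b : V3) : V3.sub a b = ⟨a.x - b.x, a.y - b.y, a.z - b.z⟩ := rfl

/-- `(p + v) - p = v`. [folklore] -/
theorem V3.add_sub_cancel_left (p v : V3) : V3.sub (V3.add p v) p = v := by
  cases p; cases v; simp [V3.sub, V3.add]

/-- `p + (q - p) = q`. [folklore] -/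
theorem V3.add_sub_cancel (p q : V3) : V3.add p (V3.sub q p) = q := by
  cases p; cases q; simp [V3.sub, V3.add]

/-- `|a - b|² = |b - a|²`. [folklore] -/
theorem V3.n2_sub_comm (a b : V3) : V3.n2 (V3.sub a b) = V3.n2 (V3.sub b a) := by
  simp only [V3.n2, V3.dot, V3.sub]; ring

namespace St

/-! ### Accessors under `push` and `link` -/

variable (s : St)

/-- The site record through `getElem?`. [folklore] -/
theorem site_eq (a : ℕ) : s.site a = (s.sites[a]?).getD default := by
  simp [site, Array.getD_eq_getD_getElem?]

/-- Size of `push`. [folklore] -/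
@[simp] theorem size_push (p : V3) (l : ℕ) : (s.push p l).size = s.size + 1 := by
  simp [push, size]

/-- Size of `link`. [folklore] -/
@[simp] theorem size_link (a b : ℕ) : (s.link a b).size = s.size := by
  simp [link, size]

/-- Cursor of `push`. [folklore] -/
@[simp] theorem cur_push (p : V3) (l : ℕ) : (s.push p l).cur = s.cur := rfl

/-- Cursor of `link`. [folklore] -/
@[simp] theorem cur_link (a b : ℕ) : (s.link a b).cur = s.cur := rfl

/-- Old sites are unchanged by `push`. [folklore] -/
theorem site_push_of_lt (p : V3) (l : ℕ) {c : ℕ} (hc : c < s.size) : (s.push p l).site c = s.site c := by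
  rw [site_eq, site_eq]
  have hne : c ≠ s.sites.size := Nat.ne_of_lt hc
  simp [push, Array.getElem?_push, hne]

/-- The new site of `push`. [folklore] -/
theorem site_push_size (p : V3) (l : ℕ) : (s.push p l).site s.size = ⟨p, l, []⟩ := by
  rw [site_eq]; simp [push, size]

/-- Positions after `push`: old ones kept, the new one is `p` (beyond: default). [folklore] -/
theorem pos_push (p : V3) (l : ℕ) (c : ℕ) :
    (s.push p l).pos c = if c < s.size then s.pos c else if c = s.size then p else default := by
  unfold pos
  split_ifs with h1 h2
  · rw [site_push_of_lt s p l h1]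
  · subst h2; rw [site_push_size]
  · rw [site_eq]
    have : (s.push p l).sites[c]? = none := Array.getElem?_eq_none (by simp [push]; unfold size at h1 h2; omega)
    simp [this]; rfl

/-- Levels after `push`. [folklore] -/
theorem lvl_push (p : V3) (l : ℕ) (c : ℕ) :
    (s.push p l).lvl c = if c < s.size then s.lvl c else if c = s.size then l else 0 := by
  unfold lvl
  split_ifs with h1 h2
  · rw [site_push_of_lt s p l h1]
  · subst h2; rw [site_push_size]
  · rw [site_eq]
    have : (s.push p l).sites[c]? = none := Array.getElem?_eq_none (by simp [push]; unfold size at h1 h2; omega)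
    simp [this]; rfl

/-- Recorded neighbours after `push`: old ones kept, the new site has none. [folklore] -/
theorem nbrs_push (p : V3) (l : ℕ) (c : ℕ) :
    (s.push p l).nbrs c = if c < s.size then s.nbrs c else [] := by
  unfold nbrs
  split_ifs with h1
  · rw [site_push_of_lt s p l h1]
  · by_cases h2 : c = s.size
    · subst h2; rw [site_push_size]
    · rw [site_eq]
      have : (s.push p l).sites[c]? = none := Array.getElem?_eq_none (by simp [push]; unfold size at h1 h2; omega)
      simp [this]; rfl

/-- Positions are unchanged by `link`. [folklore] -/
@[simp] theorem pos_link (a b c : ℕ) : (s.link a b).pos c = s.pos c := by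
  simp only [pos, site_eq, link, Array.getElem?_modify]
  split_ifs <;> cases s.sites[c]? <;> rfl

/-- Levels are unchanged by `link`. [folklore] -/
@[simp] theorem lvl_link (a b c : ℕ) : (s.link a b).lvl c = s.lvl c := by
  simp only [lvl, site_eq, link, Array.getElem?_modify]
  split_ifs <;> cases s.sites[c]? <;> rfl

/-- Recorded neighbours after `link a b` (`a, b` in range): `b` appended at `a`, `a` at `b`.
[folklore] -/
theorem nbrs_link {a b : ℕ} (ha : a < s.size) (hb : b < s.size) (c : ℕ) :
    (s.link a b).nbrs c = (s.nbrs c ++ if c = a then [b] else []) ++ if c = b then [a] else [] := by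
  have hga : s.sites[a]? = some (s.sites[a]'ha) := Array.getElem?_eq_getElem ha
  have hgb : s.sites[b]? = some (s.sites[b]'hb) := Array.getElem?_eq_getElem hb
  simp only [nbrs, site_eq, link, Array.getElem?_modify]
  by_cases hcb : b = c <;> by_cases hca : a = c
  · subst hcb; subst hca; simp [hga]
  · subst hcb; simp [hca, Ne.symm hca, hgb]
  · subst hca; simp [hcb, Ne.symm hcb, hga]
  · rw [if_neg hcb, if_neg hca, if_neg (Ne.symm hca), if_neg (Ne.symm hcb)]
    cases s.sites[c]? <;> simp

/-- Membership in the recorded neighbours after `link`. [folklore] -/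
theorem mem_nbrs_link {a b : ℕ} (ha : a < s.size) (hb : b < s.size) (c d : ℕ) :
    d ∈ (s.link a b).nbrs c ↔ d ∈ s.nbrs c ∨ (c = a ∧ d = b) ∨ (c = b ∧ d = a) := by
  rw [nbrs_link s ha hb]
  by_cases h1 : c = a <;> by_cases h2 : c = b <;> simp [h1, h2]

/-- Membership in `findAt`. [folklore] -/
theorem mem_findAt (p : V3) (a : ℕ) : a ∈ s.findAt p ↔ a < s.size ∧ s.pos a = p := by
  simp [findAt, List.mem_filter, List.mem_range]

/-- The root state. [folklore] -/
theorem root_size : root.size = 1 := rfl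

end St

end OneStacking

end Summit.AtomisticToContinuum.Crystallization.Theorems
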